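import Summits.AtomisticToContinuum.HydrodynamicLimit.Theses.InformationPercolationEngine
import Summits.AtomisticToContinuum.HydrodynamicLimit.Theorems.JParityClosureLocalSecondLawInitialLayerLLN
import HarnessLib

/-!
# The `t = 0` layer of the quenched isotropy dock: uniform-in-`x` closeness of the cone fields
(stmt-AtomisticToContinuum-15141, crux `InformationPercolationEngine.ChaosClosesEuler`, line `Sketch`,
stub `stub_initialLayer`)

The registered stub `stub_initialLayer` of the line's skeleton: under the crux's tie `TendstoHydroFieldsAt … 0`
(`χ`-tested convergence in probability of the empirical density / momentum / energy fields at time `0`) towards a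
classical hard-sphere Euler solution `(ρ, u, θ)` on `[0, T)`, `0 < T`, at every FIXED mollification radius
`r < r₀` and eventually in `N`, each of the three events "some centre `x ∈ 𝕋³` at which the `r`-cone-mollified
empirical field of `Φ_N(0) z` deviates by more than `η` from `(ρ, ρu, E)(0, x)`" has local-Gibbs probability
`≤ δ`.

Proof: the three cone-tested empirical fields `empirical{Density,Momentum,Energy}Field w (b_r(·, x))` are
DEFINITIONALLY the cone fields `rhoC/momC/kinC r w x` of `Theorems/LocalSecondLaw/Negative/Functional.lean`
(`rhoC_eq_empiricalDensityField`, `momC_eq_empiricalMomentumField`, `kinC_eq_empiricalEnergyField`, all `rfl`);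
the data slices `(ρ, u, θ)(0, ·)` are continuous (`IsHardSphereEulerSolution.smooth_*`,
`IsSmoothSpaceTimeOn.isSmooth_slice`, `IsSmooth.continuous`); the landed uniform law of large numbers
`LocalSecondLawLedger.initialLayer_uniformLLN` (finite net + centre-Lipschitz cone fields with energy-tight constants
+ uniform continuity of the data + unit mass of the kernel) gives, for `0 < r < r₀` and eventually in `N`, one event
`B` of law `≤ δ` off which all three deviations are `< η` at EVERY `x`; each of the three stub events is contained in
`B`, and monotonicity of the measure concludes. The `σ₀` of the statement is irrelevant (`σ₀ := 1`).

References: H. Spohn, *Large Scale Dynamics of Interacting Particles* (1991), Part I §3 (local Gibbs states and the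
law of large numbers at `t = 0`); C. Kipnis, C. Landim, *Scaling Limits of Interacting Particle Systems* (1999),
Ch. 4 (from tested to uniform statements via moduli of continuity).
-/

noncomputable section

namespace Summit.AtomisticToContinuum.HydrodynamicLimit.Theorems.ChaosClosesEulerInitialLayer

open scoped BigOperators Topology Classical MeasureTheory ENNReal InnerProductSpace
open Filter Set MeasureTheory
open Literature.MathematicalPhysics.KineticTheory
open Literature.Analysis.FluidPDE
open Summit.AtomisticToContinuum.HydrodynamicLimit.Theorems.LocalSecondLawNegative
open Summit.AtomisticToContinuum.HydrodynamicLimit.Theorems.LocalSecondLawLedger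

variable {N : ℕ}

/-! ## The cone-tested empirical fields are the cone fields -/

/-- The empirical density field tested against the cone `b_r(·, x)` is the mollified density `ρ_r(w)(x)`. -/
theorem rhoC_eq_empiricalDensityField (r : ℝ) (w : Phase N) (x : T3) :
    empiricalDensityField w (fun y => 3 / (Real.pi * r ^ 3) * max (1 - Torus.euclidDist y x / r) 0) =
      rhoC r w x := rfl

/-- The empirical momentum field tested against the cone `b_r(·, x)` is the mollified momentum `m_r(w)(x)`. -/
theorem momC_eq_empiricalMomentumField (r : ℝ) (w : Phase N) (x : T3) :
    empiricalMomentumField w (fun y => 3 / (Real.pi * r ^ 3) * max (1 - Torus.euclidDist y x / r) 0) =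
      momC r w x := rfl

/-- The empirical energy field tested against the cone `b_r(·, x)` is the mollified kinetic energy `e_r(w)(x)`. -/
theorem kinC_eq_empiricalEnergyField (r : ℝ) (w : Phase N) (x : T3) :
    empiricalEnergyField w (fun y => 3 / (Real.pi * r ^ 3) * max (1 - Torus.euclidDist y x / r) 0) =
      kinC r w x := rfl

/-! ## The stub -/

/-- **The `t = 0` layer** (registered stub `stub_initialLayer` of line `Sketch`, crux `ChaosClosesEuler`).  Under the
conjunct's tie `TendstoHydroFieldsAt … 0` towards a classical hard-sphere Euler solution on `[0, T)`, `0 < T`: for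
all `η, δ > 0` there is `r₀ > 0` such that for every fixed `0 < r < r₀`, eventually in `N`, each of the three events
"the `r`-cone-mollified empirical density / momentum / energy of `Φ_N(0) z` deviates by more than `η` from
`(ρ, ρu, E)(0, x)` at SOME centre `x`" has local-Gibbs probability `≤ δ` (from `initialLayer_uniformLLN`). -/
theorem stub_initialLayer :
    ∀ (a₀ θ₀ : T3 → ℝ) (u₀ : T3 → V3), Continuous a₀ → Continuous θ₀ → Continuous u₀ →
    (∀ x, 0 < a₀ x) → (∀ x, 0 < θ₀ x) → ∃ σ₀ : ℝ, 0 < σ₀ ∧ ∀ σ : ℝ, 0 < σ → σ < σ₀ →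
    ∀ (T : ℝ) (ρ θ : ℝ → T3 → ℝ) (u : ℝ → T3 → V3), IsHardSphereEulerSolution σ T ρ u θ → 0 < T →
    ∀ Φ : (N : ℕ) → HardSphereFlow (Torus.geometry (Fin 3)) (hsDiameter σ N) (N + 1),
    TendstoHydroFieldsAt (fun N => localGibbsLaw σ a₀ u₀ θ₀ N (Φ N)) Φ ρ u θ 0 →
    ∀ η δ : ℝ, 0 < η → 0 < δ → ∃ r₀ : ℝ, 0 < r₀ ∧ ∀ r : ℝ, 0 < r → r < r₀ → ∃ N₀ : ℕ, ∀ N : ℕ, N₀ ≤ N →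
    let bx : T3 → T3 → ℝ := fun y x => 3 / (Real.pi * r ^ 3) * max (1 - Torus.euclidDist y x / r) 0
    localGibbsLaw σ a₀ u₀ θ₀ N (Φ N)
        {z | ∃ x, η < |empiricalDensityField ((Φ N).flow 0 z) (fun y => bx y x) - ρ 0 x|} ≤ ENNReal.ofReal δ ∧
    localGibbsLaw σ a₀ u₀ θ₀ N (Φ N)
        {z | ∃ x, η < ‖empiricalMomentumField ((Φ N).flow 0 z) (fun y => bx y x) - ρ 0 x • u 0 x‖} ≤
          ENNReal.ofReal δ ∧
    localGibbsLaw σ a₀ u₀ θ₀ N (Φ N)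
        {z | ∃ x, η < |empiricalEnergyField ((Φ N).flow 0 z) (fun y => bx y x) -
          totalEnergyDensity (ρ 0 x) (u 0 x) (θ 0 x)|} ≤ ENNReal.ofReal δ := by
  intro a₀ θ₀ u₀ _ _ _ _ _
  refine ⟨1, one_pos, fun σ _ _ T ρ θ u hE hT Φ h0 η δ hη hδ => ?_⟩
  have h0T : (0 : ℝ) ∈ Ico 0 T := ⟨le_rfl, hT⟩
  have hρc : Continuous (ρ 0) := (hE.smooth_density.isSmooth_slice h0T).continuous
  have huc : Continuous (u 0) := (hE.smooth_velocity.isSmooth_slice h0T).continuous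
  have hθc : Continuous (θ 0) := (hE.smooth_temperature.isSmooth_slice h0T).continuous
  obtain ⟨r₀, hr₀, H⟩ :=
    initialLayer_uniformLLN (σ := σ) (a₀ := a₀) (θ₀ := θ₀) (u₀ := u₀) hρc huc hθc Φ h0 hη hδ
  refine ⟨r₀, hr₀, fun r hr hrr₀ => ?_⟩
  obtain ⟨N₀, hN₀⟩ := H r hr hrr₀
  refine ⟨N₀, fun N hN => ?_⟩
  obtain ⟨B, hB, hgood⟩ := hN₀ N hN
  intro bx
  refine ⟨(measure_mono ?_).trans hB, (measure_mono ?_).trans hB, (measure_mono ?_).trans hB⟩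
  · rintro z ⟨x, hx⟩
    by_contra hz
    rw [rhoC_eq_empiricalDensityField] at hx
    exact (not_lt.2 (hgood z hz x).1.le) hx
  · rintro z ⟨x, hx⟩
    by_contra hz
    rw [momC_eq_empiricalMomentumField] at hx
    exact (not_lt.2 (hgood z hz x).2.1.le) hx
  · rintro z ⟨x, hx⟩
    by_contra hz
    rw [kinC_eq_empiricalEnergyField] at hx
    exact (not_lt.2 (hgood z hz x).2.2.le) hx

end Summit.AtomisticToContinuum.HydrodynamicLimit.Theorems.ChaosClosesEulerInitialLayer

end
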